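import Mathlib
import HarnessLib
import Summits.NavierStokesRegularity.NavierStokesRegularity.Theorems.PoloidalWindowDoorLrcModEntireTwistingTHOscAncientLiouville

/-!
# Item `LrcModEntire` (stmt-NavierStokesRegularity-20428), skeleton twist_split v6, CLASS road to `stub_twistingTHGerm` —
# the weighted-mass decay law WITH FORCING for the similarity-variable plane-oscillation law, and the ancient bound `M ≤ (β/γ)·P`

Cell ns-regularity-ideate, seat ns-k2-port-2 g4 (kernel-port lineage; `--supports stmt-NavierStokesRegularity-20428 --as helper`; sequel of
`…TwistingTHOscAncientLiouville` (port-2 g3) / `…TwistingTHOscAncientLiouvilleDecay`).  Same setting as the decay law: a universal weight `w`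
(`w″ + ½(ξ+s)w′ ≤ −γw` for `|s| ≤ A`, `γ > 0`), `Q ≥ 0` polynomially bounded with `Qt, Q_ξ, Q_ξξ`, `|Ŝ| ≤ A`, but now the subsolution
inequality carries a FORCING term `F` (continuous in `ξ`, `|F| ≤ β(1+ξ²)^k`):
    `Q_τ + ½∂_ξ((ξ+Ŝ)Q) ≤ Q_ξξ + F`.
With `M(τ) := ∫ Q(τ,ξ)w(ξ)dξ` and `P := ∫ (1+ξ²)^k w(ξ)dξ`:

* `weightedMass_decay_forced` — `M(τ₁) ≤ e^{−γ(τ₁−τ₀)}·M(τ₀) + (β/γ)·P` for `τ₀ ≤ τ₁` (Grönwall with the source `∫F w ≤ βP`);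
* `weightedMass_le_of_forced` — hence, `Q` being defined for ALL `τ` (ancient) and polynomially bounded uniformly in `τ`, `M(τ) ≤ (β/γ)·P` for every `τ`.

USE (next file `…TwistingTHOscSignedLiouville`): for a smooth SIGNED solution `U` of `U·(U_τ + ½∂_ξ((ξ+Ŝ)U) − U_ξξ) ≤ 0` the regularisations
`Q_ε = √(U² + ε²)` are forced subsolutions with `β = O(ε)`, so `∫|U|w ≤ ∫Q_ε w ≤ O(ε)` ⇒ `U ≡ 0` — the Kato form of the ancient Liouville theorem,
which is what the (BRANCH) object `(1−μ)(Θ⁺ − Θ⁻)` of the LEAD's memo OSC-LIOUVILLE-g13 §5septies satisfies on both signs of `1−μ`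
(the «μ = 1 planes» residual point).

WHAT THIS IS NOT: not a claim about Navier–Stokes regularity and not the stub (bears_on LADDER-NS N0, item 20428 / crux 19708; both OPEN).
-/

noncomputable section

-- the summit and its single sub-problem share the name (CONVENTIONS §1), as in every Theorems file
set_option linter.dupNamespace false

namespace Summit.NavierStokesRegularity.NavierStokesRegularity.Theorems.PoloidalWindowDoorLrcModEntireTwistingTHOscAncientLiouvilleForced

open MeasureTheory Set Filter Topology

open Summit.NavierStokesRegularity.NavierStokesRegularity.Theorems.PoloidalWindowDoorLrcModEntireTwistingTHOscAncientLiouville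

/-! ### The decay inequality with forcing -/

/-- **THE DECAY INEQUALITY OF THE WEIGHTED MASS, WITH FORCING.**  For a polynomially bounded non-negative FORCED subsolution
`Q_τ + ½∂_ξ((ξ+Ŝ)Q) ≤ Q_ξξ + F`, `|F| ≤ β(1+ξ²)^k`, and a universal weight with rate `γ > 0` (module docstring):
`M(τ) := ∫ Q(τ,ξ)w(ξ)dξ` is finite and `M(τ₁) ≤ e^{−γ(τ₁−τ₀)}·M(τ₀) + (β/γ)·∫(1+ξ²)^k w` whenever `τ₀ ≤ τ₁`. -/
theorem weightedMass_decay_forced {Q Qt S F : ℝ → ℝ → ℝ} {w : ℝ → ℝ} {A γ C β : ℝ} {k : ℕ}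
    -- the weight
    (hw : ContDiff ℝ 2 w) (hwpos : ∀ ξ, 0 < w ξ) (hγ : 0 < γ)
    (hLw : ∀ ξ s : ℝ, |s| ≤ A → deriv (deriv w) ξ + (1 / 2 : ℝ) * (ξ + s) * deriv w ξ ≤ -γ * w ξ)
    (hWint : Integrable fun ξ => (1 + ξ ^ 2) ^ (2 * k + 1) * (|w ξ| + |deriv w ξ| + |deriv (deriv w) ξ|))
    -- the forced subsolution (polynomially bounded, not necessarily bounded)
    (hQ2 : ∀ τ, ContDiff ℝ 2 (Q τ)) (hQt : ∀ τ ξ, HasDerivAt (fun τ' => Q τ' ξ) (Qt τ ξ) τ) (hQtc : ∀ τ, Continuous (Qt τ))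
    (h0 : ∀ τ ξ, 0 ≤ Q τ ξ) (hQb : ∀ τ ξ, |Q τ ξ| ≤ C * (1 + ξ ^ 2) ^ k)
    (hQtb : ∀ τ ξ, |Qt τ ξ| ≤ C * (1 + ξ ^ 2) ^ k) (hQ1b : ∀ τ ξ, |deriv (Q τ) ξ| ≤ C * (1 + ξ ^ 2) ^ k)
    (hQ2b : ∀ τ ξ, |deriv (deriv (Q τ)) ξ| ≤ C * (1 + ξ ^ 2) ^ k)
    (hS : ∀ τ, ContDiff ℝ 1 (S τ)) (hSA : ∀ τ ξ, |S τ ξ| ≤ A) (hS1b : ∀ τ ξ, |deriv (S τ) ξ| ≤ C * (1 + ξ ^ 2) ^ k)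
    (hFc : ∀ τ, Continuous (F τ)) (hFb : ∀ τ ξ, |F τ ξ| ≤ β * (1 + ξ ^ 2) ^ k)
    (hsub : ∀ τ ξ, Qt τ ξ + (1 / 2 : ℝ) * deriv (fun ξ => (ξ + S τ ξ) * Q τ ξ) ξ ≤ deriv (deriv (Q τ)) ξ + F τ ξ) :
    (∀ τ, Integrable fun ξ => Q τ ξ * w ξ) ∧
    ∀ τ₀ τ₁, τ₀ ≤ τ₁ → ∫ ξ, Q τ₁ ξ * w ξ ≤
      Real.exp (-(γ * (τ₁ - τ₀))) * (∫ ξ, Q τ₀ ξ * w ξ) + β / γ * ∫ ξ, (1 + ξ ^ 2) ^ k * w ξ := by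
  have hC0 : 0 ≤ C := by
    have := (abs_nonneg _).trans (hQtb 0 0)
    have hP : 0 < (1 + (0 : ℝ) ^ 2) ^ k := by positivity
    nlinarith
  have hβ0 : 0 ≤ β := by
    have := (abs_nonneg _).trans (hFb 0 0)
    have hP : 0 < (1 + (0 : ℝ) ^ 2) ^ k := by positivity
    nlinarith
  have hA0 : 0 ≤ A := (abs_nonneg _).trans (hSA 0 0)
  set G : ℝ → ℝ := fun ξ => (1 + ξ ^ 2) ^ (2 * k + 1) * (|w ξ| + |deriv w ξ| + |deriv (deriv w) ξ|) with hG
  have hP1 : ∀ ξ : ℝ, 1 ≤ (1 + ξ ^ 2) ^ k := fun ξ => one_le_pow₀ (by nlinarith [sq_nonneg ξ])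
  have hPk : ∀ ξ : ℝ, (1 + ξ ^ 2) ^ k ≤ (1 + ξ ^ 2) ^ (2 * k + 1) := fun ξ =>
    pow_le_pow_right₀ (by nlinarith [sq_nonneg ξ]) (by omega)
  have hPk1 : ∀ ξ : ℝ, (1 + ξ ^ 2) ^ (k + 1) ≤ (1 + ξ ^ 2) ^ (2 * k + 1) := fun ξ =>
    pow_le_pow_right₀ (by nlinarith [sq_nonneg ξ]) (by omega)
  have hPkk : ∀ ξ : ℝ, (1 + ξ ^ 2) ^ k * (1 + ξ ^ 2) ^ k ≤ (1 + ξ ^ 2) ^ (2 * k + 1) := fun ξ => by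
    rw [← pow_add]; exact pow_le_pow_right₀ (by nlinarith [sq_nonneg ξ]) (by omega)
  have hPk' : ∀ ξ : ℝ, (1 + |ξ|) * (1 + ξ ^ 2) ^ k ≤ 2 * (1 + ξ ^ 2) ^ (2 * k + 1) := fun ξ => by
    have h1 := one_add_abs_le ξ
    have h2 : 0 ≤ (1 + ξ ^ 2) ^ k := by positivity
    calc (1 + |ξ|) * (1 + ξ ^ 2) ^ k ≤ (2 * (1 + ξ ^ 2)) * (1 + ξ ^ 2) ^ k := mul_le_mul_of_nonneg_right h1 h2
      _ = 2 * (1 + ξ ^ 2) ^ (k + 1) := by ring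
      _ ≤ 2 * (1 + ξ ^ 2) ^ (2 * k + 1) := by linarith [hPk1 ξ]
  have hP1' : ∀ ξ : ℝ, 1 ≤ (1 + ξ ^ 2) ^ (2 * k + 1) := fun ξ => one_le_pow₀ (by nlinarith [sq_nonneg ξ])
  have hwd : Differentiable ℝ w := hw.differentiable (by norm_num)
  have hw1 : ContDiff ℝ 1 (deriv w) := by
    have h2 : ContDiff ℝ (1 + 1) w := by rwa [one_add_one_eq_two]
    exact h2.deriv'
  have hw'd : Differentiable ℝ (deriv w) := hw1.differentiable (by norm_num)
  have hwc : Continuous w := hwd.continuous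
  have hw'c : Continuous (deriv w) := hw'd.continuous
  have hw''c : Continuous (deriv (deriv w)) := hw1.continuous_deriv le_rfl
  have hGw : ∀ ξ, (1 + ξ ^ 2) ^ (2 * k + 1) * |w ξ| ≤ G ξ := fun ξ => by
    simp only [hG]; nlinarith [abs_nonneg (deriv w ξ), abs_nonneg (deriv (deriv w) ξ), hP1' ξ]
  have hGw' : ∀ ξ, (1 + ξ ^ 2) ^ (2 * k + 1) * |deriv w ξ| ≤ G ξ := fun ξ => by
    simp only [hG]; nlinarith [abs_nonneg (w ξ), abs_nonneg (deriv (deriv w) ξ), hP1' ξ]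
  have hGw'' : ∀ ξ, (1 + ξ ^ 2) ^ (2 * k + 1) * |deriv (deriv w) ξ| ≤ G ξ := fun ξ => by
    simp only [hG]; nlinarith [abs_nonneg (w ξ), abs_nonneg (deriv w ξ), hP1' ξ]
  -- the polynomial moment `P = ∫ (1+ξ²)^k w` is finite
  have hPc : Continuous fun ξ : ℝ => (1 + ξ ^ 2) ^ k := (continuous_const.add (continuous_pow 2)).pow k
  have iPw : Integrable fun ξ => (1 + ξ ^ 2) ^ k * w ξ := integrable_of_abs_le (hPc.mul hwc) hWint 1 fun ξ => by
    have hb : |(1 + ξ ^ 2) ^ k| ≤ 1 * (1 + ξ ^ 2) ^ k := by rw [abs_of_nonneg (by positivity), one_mul]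
    exact abs_mul_le_of_bounds zero_le_one hb (hPk ξ) (hGw ξ)
  -- ## Step 1: for each `τ`, the weighted-mass inequality `∫ Qt·w ≤ −γ ∫ Q·w + β·P`
  have hstep : ∀ τ, Integrable (fun ξ => Q τ ξ * w ξ) ∧ Integrable (fun ξ => Qt τ ξ * w ξ) ∧
      ∫ ξ, Qt τ ξ * w ξ ≤ -γ * (∫ ξ, Q τ ξ * w ξ) + β * ∫ ξ, (1 + ξ ^ 2) ^ k * w ξ := by
    intro τ
    have hq2 := hQ2 τ
    have hqd : Differentiable ℝ (Q τ) := hq2.differentiable (by norm_num)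
    have hq1 : ContDiff ℝ 1 (deriv (Q τ)) := by
      have h2 : ContDiff ℝ (1 + 1) (Q τ) := by rw [one_add_one_eq_two]; exact hq2
      exact h2.deriv'
    have hq'd : Differentiable ℝ (deriv (Q τ)) := hq1.differentiable (by norm_num)
    have hqc : Continuous (Q τ) := hqd.continuous
    have hq'c : Continuous (deriv (Q τ)) := hq'd.continuous
    have hq''c : Continuous (deriv (deriv (Q τ))) := hq1.continuous_deriv le_rfl
    have hsd : Differentiable ℝ (S τ) := (hS τ).differentiable (by norm_num)
    have hsc : Continuous (S τ) := hsd.continuous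
    have hs'c : Continuous (deriv (S τ)) := (hS τ).continuous_deriv le_rfl
    set V : ℝ → ℝ := fun ξ => (ξ + S τ ξ) * Q τ ξ with hV
    have hVd : ∀ ξ, HasDerivAt V ((1 + deriv (S τ) ξ) * Q τ ξ + (ξ + S τ ξ) * deriv (Q τ) ξ) ξ := by
      intro ξ
      have h1 : HasDerivAt (fun ξ => ξ + S τ ξ) (1 + deriv (S τ) ξ) ξ := (hasDerivAt_id ξ).add (hsd ξ).hasDerivAt
      exact h1.mul (hqd ξ).hasDerivAt
    have hV' : deriv V = fun ξ => (1 + deriv (S τ) ξ) * Q τ ξ + (ξ + S τ ξ) * deriv (Q τ) ξ := funext fun ξ => (hVd ξ).deriv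
    have hVc : Continuous V := by rw [hV]; exact (continuous_id.add hsc).mul hqc
    have hV'c : Continuous (deriv V) := by
      rw [hV']; exact ((continuous_const.add hs'c).mul hqc).add ((continuous_id.add hsc).mul hq'c)
    have bQ : ∀ ξ, |Q τ ξ| ≤ C * (1 + ξ ^ 2) ^ k := hQb τ
    have bV : ∀ ξ, |V ξ| ≤ 2 * C * (1 + A) * (1 + ξ ^ 2) ^ (2 * k + 1) := by
      intro ξ
      have h1 : |ξ + S τ ξ| ≤ |ξ| + A := (abs_add_le _ _).trans (by linarith [hSA τ ξ])
      have h3 : |ξ| + A ≤ (1 + A) * (1 + |ξ|) := by nlinarith [abs_nonneg ξ, mul_nonneg hA0 (abs_nonneg ξ)]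
      rw [hV]
      show |(ξ + S τ ξ) * Q τ ξ| ≤ _
      rw [abs_mul]
      calc |ξ + S τ ξ| * |Q τ ξ| ≤ ((1 + A) * (1 + |ξ|)) * (C * (1 + ξ ^ 2) ^ k) :=
            mul_le_mul (h1.trans h3) (bQ ξ) (abs_nonneg _) (by positivity)
        _ = (1 + A) * C * ((1 + |ξ|) * (1 + ξ ^ 2) ^ k) := by ring
        _ ≤ (1 + A) * C * (2 * (1 + ξ ^ 2) ^ (2 * k + 1)) := mul_le_mul_of_nonneg_left (hPk' ξ) (by positivity)
        _ = 2 * C * (1 + A) * (1 + ξ ^ 2) ^ (2 * k + 1) := by ring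
    have bV' : ∀ ξ, |deriv V ξ| ≤ (C + C ^ 2 + 2 * C * (1 + A)) * (1 + ξ ^ 2) ^ (2 * k + 1) := by
      intro ξ
      rw [hV']
      set P := (1 + ξ ^ 2) ^ k with hP
      set P₂ := (1 + ξ ^ 2) ^ (2 * k + 1) with hP₂
      have hP0 : 0 ≤ P := by positivity
      have h1 : |(1 + deriv (S τ) ξ) * Q τ ξ| ≤ (1 + C * P) * (C * P) := by
        rw [abs_mul]
        exact mul_le_mul ((abs_add_le _ _).trans (by rw [abs_one]; linarith [hS1b τ ξ])) (bQ ξ) (abs_nonneg _)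
          (by nlinarith [hP1 ξ])
      have h2 : |(ξ + S τ ξ) * deriv (Q τ) ξ| ≤ (|ξ| + A) * (C * P) := by
        rw [abs_mul]
        exact mul_le_mul ((abs_add_le _ _).trans (by linarith [hSA τ ξ])) (hQ1b τ ξ) (abs_nonneg _)
          (by linarith [abs_nonneg ξ])
      have h3 := hPk ξ
      have h4 := hPk' ξ
      have h5 := hPkk ξ
      have h1' : (1 + C * P) * (C * P) ≤ (C + C ^ 2) * P₂ := by
        have e : (1 + C * P) * (C * P) = C * P + C ^ 2 * (P * P) := by ring
        rw [e]; nlinarith [mul_nonneg hC0 (sub_nonneg.2 h3), mul_nonneg (sq_nonneg C) (sub_nonneg.2 h5)]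
      have h2' : (|ξ| + A) * (C * P) ≤ 2 * C * (1 + A) * P₂ := by
        have h6 : |ξ| + A ≤ (1 + A) * (1 + |ξ|) := by nlinarith [abs_nonneg ξ, mul_nonneg hA0 (abs_nonneg ξ)]
        calc (|ξ| + A) * (C * P) ≤ ((1 + A) * (1 + |ξ|)) * (C * P) := mul_le_mul_of_nonneg_right h6 (by positivity)
          _ = (1 + A) * C * ((1 + |ξ|) * P) := by ring
          _ ≤ (1 + A) * C * (2 * P₂) := mul_le_mul_of_nonneg_left h4 (by positivity)
          _ = 2 * C * (1 + A) * P₂ := by ring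
      calc |(1 + deriv (S τ) ξ) * Q τ ξ + (ξ + S τ ξ) * deriv (Q τ) ξ|
          ≤ (1 + C * P) * (C * P) + (|ξ| + A) * (C * P) := (abs_add_le _ _).trans (add_le_add h1 h2)
        _ ≤ (C + C ^ 2) * P₂ + 2 * C * (1 + A) * P₂ := add_le_add h1' h2'
        _ = (C + C ^ 2 + 2 * C * (1 + A)) * P₂ := by ring
    have iQw : Integrable fun ξ => Q τ ξ * w ξ := integrable_of_abs_le (hqc.mul hwc) hWint C fun ξ =>
      abs_mul_le_of_bounds hC0 (bQ ξ) (hPk ξ) (hGw ξ)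
    have iQtw : Integrable fun ξ => Qt τ ξ * w ξ := integrable_of_abs_le ((hQtc τ).mul hwc) hWint C fun ξ =>
      abs_mul_le_of_bounds hC0 (hQtb τ ξ) (hPk ξ) (hGw ξ)
    have iFw : Integrable fun ξ => F τ ξ * w ξ := integrable_of_abs_le ((hFc τ).mul hwc) hWint β fun ξ =>
      abs_mul_le_of_bounds hβ0 (hFb τ ξ) (hPk ξ) (hGw ξ)
    have iQ''w : Integrable fun ξ => w ξ * deriv (deriv (Q τ)) ξ := integrable_of_abs_le (hwc.mul hq''c) hWint C fun ξ =>
      abs_mul_le_of_bounds' hC0 (hQ2b τ ξ) (hPk ξ) (hGw ξ)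
    have iQ'w' : Integrable fun ξ => deriv w ξ * deriv (Q τ) ξ := integrable_of_abs_le (hw'c.mul hq'c) hWint C fun ξ =>
      abs_mul_le_of_bounds' hC0 (hQ1b τ ξ) (hPk ξ) (hGw' ξ)
    have iQ'w : Integrable fun ξ => w ξ * deriv (Q τ) ξ := integrable_of_abs_le (hwc.mul hq'c) hWint C fun ξ =>
      abs_mul_le_of_bounds' hC0 (hQ1b τ ξ) (hPk ξ) (hGw ξ)
    have iQw'' : Integrable fun ξ => deriv (deriv w) ξ * Q τ ξ := integrable_of_abs_le (hw''c.mul hqc) hWint C fun ξ =>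
      abs_mul_le_of_bounds' hC0 (bQ ξ) (hPk ξ) (hGw'' ξ)
    have iQw' : Integrable fun ξ => deriv w ξ * Q τ ξ := integrable_of_abs_le (hw'c.mul hqc) hWint C fun ξ =>
      abs_mul_le_of_bounds' hC0 (bQ ξ) (hPk ξ) (hGw' ξ)
    have hK1 : 0 ≤ C + C ^ 2 + 2 * C * (1 + A) := by positivity
    have hK2 : 0 ≤ 2 * C * (1 + A) := by positivity
    have iwV' : Integrable fun ξ => w ξ * deriv V ξ :=
      integrable_of_abs_le (hwc.mul hV'c) hWint (C + C ^ 2 + 2 * C * (1 + A)) fun ξ =>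
        abs_mul_le_of_bounds' hK1 (bV' ξ) le_rfl (hGw ξ)
    have iw'V : Integrable fun ξ => deriv w ξ * V ξ :=
      integrable_of_abs_le (hw'c.mul hVc) hWint (2 * C * (1 + A)) fun ξ =>
        abs_mul_le_of_bounds' hK2 (bV ξ) le_rfl (hGw' ξ)
    have iwV : Integrable fun ξ => w ξ * V ξ :=
      integrable_of_abs_le (hwc.mul hVc) hWint (2 * C * (1 + A)) fun ξ =>
        abs_mul_le_of_bounds' hK2 (bV ξ) le_rfl (hGw ξ)
    have ibp1 : ∫ ξ, w ξ * deriv (deriv (Q τ)) ξ = -∫ ξ, deriv w ξ * deriv (Q τ) ξ :=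
      integral_mul_deriv_eq_deriv_mul_of_integrable (u := w) (v := deriv (Q τ)) (u' := deriv w) (v' := deriv (deriv (Q τ)))
        (fun ξ _ => (hwd ξ).hasDerivAt) (fun ξ _ => (hq'd ξ).hasDerivAt) iQ''w iQ'w' iQ'w
    have ibp2 : ∫ ξ, deriv w ξ * deriv (Q τ) ξ = -∫ ξ, deriv (deriv w) ξ * Q τ ξ :=
      integral_mul_deriv_eq_deriv_mul_of_integrable (u := deriv w) (v := Q τ) (u' := deriv (deriv w)) (v' := deriv (Q τ))
        (fun ξ _ => (hw'd ξ).hasDerivAt) (fun ξ _ => (hqd ξ).hasDerivAt) iQ'w' iQw'' iQw'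
    have ibp3 : ∫ ξ, w ξ * deriv V ξ = -∫ ξ, deriv w ξ * V ξ :=
      integral_mul_deriv_eq_deriv_mul_of_integrable (u := w) (v := V) (u' := deriv w) (v' := deriv V)
        (fun ξ _ => (hwd ξ).hasDerivAt) (fun ξ _ => (hVd ξ).differentiableAt.hasDerivAt) iwV' iw'V iwV
    have hderivV : ∀ ξ, deriv (fun ξ => (ξ + S τ ξ) * Q τ ξ) ξ = deriv V ξ := fun ξ => by rw [hV]
    have iD : Integrable fun ξ => w ξ * deriv (deriv (Q τ)) ξ - (1 / 2 : ℝ) * (w ξ * deriv V ξ) :=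
      iQ''w.sub (iwV'.const_mul _)
    have hpt : ∀ ξ, Qt τ ξ * w ξ ≤ (w ξ * deriv (deriv (Q τ)) ξ - (1 / 2 : ℝ) * (w ξ * deriv V ξ)) + F τ ξ * w ξ := by
      intro ξ
      have h := hsub τ ξ
      rw [hderivV ξ] at h
      have hw0 := (hwpos ξ).le
      nlinarith [mul_le_mul_of_nonneg_right h hw0]
    have hI1 : ∫ ξ, Qt τ ξ * w ξ ≤ ∫ ξ, ((w ξ * deriv (deriv (Q τ)) ξ - (1 / 2 : ℝ) * (w ξ * deriv V ξ)) + F τ ξ * w ξ) :=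
      integral_mono iQtw (iD.add iFw) hpt
    have hI2 : ∫ ξ, ((w ξ * deriv (deriv (Q τ)) ξ - (1 / 2 : ℝ) * (w ξ * deriv V ξ)) + F τ ξ * w ξ) =
        (∫ ξ, (deriv (deriv w) ξ * Q τ ξ + (1 / 2 : ℝ) * (deriv w ξ * V ξ))) + ∫ ξ, F τ ξ * w ξ := by
      rw [integral_add iD iFw, integral_sub iQ''w (iwV'.const_mul _), integral_const_mul,
        ibp1, ibp2, ibp3, integral_add iQw'' (iw'V.const_mul _), integral_const_mul]
      ring
    have hpt2 : ∀ ξ, deriv (deriv w) ξ * Q τ ξ + (1 / 2 : ℝ) * (deriv w ξ * V ξ) ≤ -γ * (Q τ ξ * w ξ) := by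
      intro ξ
      have h := hLw ξ (S τ ξ) (hSA τ ξ)
      have hq0 := h0 τ ξ
      have e : deriv (deriv w) ξ * Q τ ξ + (1 / 2 : ℝ) * (deriv w ξ * V ξ) =
          (deriv (deriv w) ξ + (1 / 2 : ℝ) * (ξ + S τ ξ) * deriv w ξ) * Q τ ξ := by rw [hV]; ring
      rw [e]
      nlinarith [mul_le_mul_of_nonneg_right h hq0]
    have hI3 : ∫ ξ, (deriv (deriv w) ξ * Q τ ξ + (1 / 2 : ℝ) * (deriv w ξ * V ξ)) ≤ ∫ ξ, -γ * (Q τ ξ * w ξ) :=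
      integral_mono (iQw''.add (iw'V.const_mul _)) (iQw.const_mul _) hpt2
    have hpt3 : ∀ ξ, F τ ξ * w ξ ≤ β * ((1 + ξ ^ 2) ^ k * w ξ) := by
      intro ξ
      have h := (le_abs_self _).trans (hFb τ ξ)
      have hw0 := (hwpos ξ).le
      nlinarith [mul_le_mul_of_nonneg_right h hw0]
    have hI4 : ∫ ξ, F τ ξ * w ξ ≤ ∫ ξ, β * ((1 + ξ ^ 2) ^ k * w ξ) := integral_mono iFw (iPw.const_mul β) hpt3
    refine ⟨iQw, iQtw, ?_⟩
    calc ∫ ξ, Qt τ ξ * w ξ ≤ _ := hI1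
      _ = _ := hI2
      _ ≤ (∫ ξ, -γ * (Q τ ξ * w ξ)) + ∫ ξ, β * ((1 + ξ ^ 2) ^ k * w ξ) := add_le_add hI3 hI4
      _ = -γ * (∫ ξ, Q τ ξ * w ξ) + β * ∫ ξ, (1 + ξ ^ 2) ^ k * w ξ := by rw [integral_const_mul, integral_const_mul]
  -- ## Step 2: `I(τ) = ∫ Q w` is differentiable with `I′ = ∫ Qt w`
  set I : ℝ → ℝ := fun τ => ∫ ξ, Q τ ξ * w ξ with hI
  set Pw : ℝ := ∫ ξ, (1 + ξ ^ 2) ^ k * w ξ with hPw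
  have hIderiv : ∀ τ, HasDerivAt I (∫ ξ, Qt τ ξ * w ξ) τ := by
    intro τ₀
    have h := hasDerivAt_integral_of_dominated_loc_of_deriv_le (μ := volume) (F := fun τ ξ => Q τ ξ * w ξ)
      (F' := fun τ ξ => Qt τ ξ * w ξ) (x₀ := τ₀) (s := univ) (bound := fun ξ => C * (1 + ξ ^ 2) ^ k * |w ξ|) univ_mem
      (Eventually.of_forall fun τ => (hstep τ).1.aestronglyMeasurable) (hstep τ₀).1 (hstep τ₀).2.1.aestronglyMeasurable
      (Eventually.of_forall fun ξ τ _ => by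
        rw [Real.norm_eq_abs, abs_mul]
        exact mul_le_mul_of_nonneg_right (hQtb τ ξ) (abs_nonneg _))
      (integrable_of_abs_le ((continuous_const.mul hPc).mul hwc.abs) hWint C
        fun ξ => by
          have hb : |C * (1 + ξ ^ 2) ^ k| ≤ C * (1 + ξ ^ 2) ^ k := by
            rw [abs_of_nonneg (by positivity)]
          have hg' : (1 + ξ ^ 2) ^ (2 * k + 1) * |(|w ξ|)| ≤ G ξ := by rw [abs_abs]; exact hGw ξ
          have h := abs_mul_le_of_bounds (G := G ξ) hC0 hb (hPk ξ) hg'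
          simpa [mul_assoc] using h)
      (Eventually.of_forall fun ξ τ _ => (hQt τ ξ).mul_const (w ξ))
    exact h.2
  -- ## Step 3: `e^{γτ}(I(τ) − βP/γ)` is non-increasing, hence `I(τ) ≤ e^{−γ(τ−τ₀)} I(τ₀) + βP/γ`
  have hPw0 : 0 ≤ Pw := integral_nonneg fun ξ => mul_nonneg (by positivity) (hwpos ξ).le
  have hD0 : 0 ≤ β / γ * Pw := mul_nonneg (div_nonneg hβ0 hγ.le) hPw0
  set J : ℝ → ℝ := fun τ => Real.exp (γ * τ) * (I τ - β / γ * Pw) with hJ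
  have hJd : ∀ τ, HasDerivAt J (Real.exp (γ * τ) * (γ * (I τ - β / γ * Pw) + ∫ ξ, Qt τ ξ * w ξ)) τ := by
    intro τ
    have he : HasDerivAt (fun τ => Real.exp (γ * τ)) (Real.exp (γ * τ) * γ) τ := by
      have h := ((hasDerivAt_id τ).const_mul γ).exp
      simpa using h
    exact (he.mul ((hIderiv τ).sub_const (β / γ * Pw))).congr_deriv (by ring)
  have hJanti : Antitone J := by
    refine antitone_of_deriv_nonpos (fun τ => (hJd τ).differentiableAt) fun τ => ?_
    rw [(hJd τ).deriv]
    have h := (hstep τ).2.2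
    have e : γ * (I τ - β / γ * Pw) = γ * I τ - β * Pw := by field_simp
    have : γ * (I τ - β / γ * Pw) + ∫ ξ, Qt τ ξ * w ξ ≤ 0 := by rw [e]; simp only [hI, hPw] at h ⊢; linarith
    exact mul_nonpos_of_nonneg_of_nonpos (Real.exp_pos _).le this
  refine ⟨fun τ => (hstep τ).1, fun τ₀ τ hle => ?_⟩
  have hJ' : J τ ≤ J τ₀ := hJanti hle
  simp only [hJ] at hJ'
  have he : Real.exp (γ * τ) = Real.exp (γ * τ₀) * Real.exp (γ * (τ - τ₀)) := by
    rw [← Real.exp_add]; ring_nf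
  have hpos := Real.exp_pos (γ * (τ - τ₀))
  have hpos0 := Real.exp_pos (γ * τ₀)
  have h2 : Real.exp (γ * (τ - τ₀)) * (I τ - β / γ * Pw) ≤ I τ₀ - β / γ * Pw := by
    have h3 : Real.exp (γ * τ₀) * (Real.exp (γ * (τ - τ₀)) * (I τ - β / γ * Pw)) ≤ Real.exp (γ * τ₀) * (I τ₀ - β / γ * Pw) := by
      rw [← mul_assoc, ← he]; exact hJ'
    exact le_of_mul_le_mul_left h3 hpos0
  show I τ ≤ Real.exp (-(γ * (τ - τ₀))) * I τ₀ + β / γ * Pw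
  rw [Real.exp_neg]
  have e3 : I τ - β / γ * Pw = (Real.exp (γ * (τ - τ₀)))⁻¹ * (Real.exp (γ * (τ - τ₀)) * (I τ - β / γ * Pw)) := by
    field_simp
  have h4 : I τ - β / γ * Pw ≤ (Real.exp (γ * (τ - τ₀)))⁻¹ * (I τ₀ - β / γ * Pw) := by
    rw [e3]; exact mul_le_mul_of_nonneg_left h2 (inv_nonneg.2 hpos.le)
  have h5 : (Real.exp (γ * (τ - τ₀)))⁻¹ * (I τ₀ - β / γ * Pw) ≤ (Real.exp (γ * (τ - τ₀)))⁻¹ * I τ₀ := by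
    have : I τ₀ - β / γ * Pw ≤ I τ₀ := by linarith
    exact mul_le_mul_of_nonneg_left this (inv_nonneg.2 hpos.le)
  linarith

/-! ### The ancient bound -/

/-- **ANCIENT FORCED SUBSOLUTIONS HAVE WEIGHTED MASS `≤ (β/γ)·P`.**  Under the hypotheses of `weightedMass_decay_forced` (the forced
subsolution being defined and polynomially bounded for ALL `τ ∈ ℝ`), `∫ Q(τ,ξ)w(ξ)dξ ≤ (β/γ)·∫(1+ξ²)^k w(ξ)dξ` for every `τ`
(let `τ₀ → −∞` in the decay law: `e^{−γ(τ−τ₀)}·M(τ₀) ≤ e^{−γ(τ−τ₀)}·C·P → 0`). -/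
theorem weightedMass_le_of_forced {Q Qt S F : ℝ → ℝ → ℝ} {w : ℝ → ℝ} {A γ C β : ℝ} {k : ℕ}
    (hw : ContDiff ℝ 2 w) (hwpos : ∀ ξ, 0 < w ξ) (hγ : 0 < γ)
    (hLw : ∀ ξ s : ℝ, |s| ≤ A → deriv (deriv w) ξ + (1 / 2 : ℝ) * (ξ + s) * deriv w ξ ≤ -γ * w ξ)
    (hWint : Integrable fun ξ => (1 + ξ ^ 2) ^ (2 * k + 1) * (|w ξ| + |deriv w ξ| + |deriv (deriv w) ξ|))
    (hQ2 : ∀ τ, ContDiff ℝ 2 (Q τ)) (hQt : ∀ τ ξ, HasDerivAt (fun τ' => Q τ' ξ) (Qt τ ξ) τ) (hQtc : ∀ τ, Continuous (Qt τ))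
    (h0 : ∀ τ ξ, 0 ≤ Q τ ξ) (hQb : ∀ τ ξ, |Q τ ξ| ≤ C * (1 + ξ ^ 2) ^ k)
    (hQtb : ∀ τ ξ, |Qt τ ξ| ≤ C * (1 + ξ ^ 2) ^ k) (hQ1b : ∀ τ ξ, |deriv (Q τ) ξ| ≤ C * (1 + ξ ^ 2) ^ k)
    (hQ2b : ∀ τ ξ, |deriv (deriv (Q τ)) ξ| ≤ C * (1 + ξ ^ 2) ^ k)
    (hS : ∀ τ, ContDiff ℝ 1 (S τ)) (hSA : ∀ τ ξ, |S τ ξ| ≤ A) (hS1b : ∀ τ ξ, |deriv (S τ) ξ| ≤ C * (1 + ξ ^ 2) ^ k)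
    (hFc : ∀ τ, Continuous (F τ)) (hFb : ∀ τ ξ, |F τ ξ| ≤ β * (1 + ξ ^ 2) ^ k)
    (hsub : ∀ τ ξ, Qt τ ξ + (1 / 2 : ℝ) * deriv (fun ξ => (ξ + S τ ξ) * Q τ ξ) ξ ≤ deriv (deriv (Q τ)) ξ + F τ ξ) :
    (∀ τ, Integrable fun ξ => Q τ ξ * w ξ) ∧
    ∀ τ, ∫ ξ, Q τ ξ * w ξ ≤ β / γ * ∫ ξ, (1 + ξ ^ 2) ^ k * w ξ := by
  obtain ⟨hint, hdecay⟩ := weightedMass_decay_forced hw hwpos hγ hLw hWint hQ2 hQt hQtc h0 hQb hQtb hQ1b hQ2b hS hSA hS1b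
    hFc hFb hsub
  have hC0 : 0 ≤ C := by
    have := (abs_nonneg _).trans (hQtb 0 0)
    have hP : 0 < (1 + (0 : ℝ) ^ 2) ^ k := by positivity
    nlinarith
  have hwc : Continuous w := hw.continuous
  have hPc : Continuous fun ξ : ℝ => (1 + ξ ^ 2) ^ k := (continuous_const.add (continuous_pow 2)).pow k
  have hP1' : ∀ ξ : ℝ, 1 ≤ (1 + ξ ^ 2) ^ (2 * k + 1) := fun ξ => one_le_pow₀ (by nlinarith [sq_nonneg ξ])
  have hPk : ∀ ξ : ℝ, (1 + ξ ^ 2) ^ k ≤ (1 + ξ ^ 2) ^ (2 * k + 1) := fun ξ =>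
    pow_le_pow_right₀ (by nlinarith [sq_nonneg ξ]) (by omega)
  have hGw : ∀ ξ, (1 + ξ ^ 2) ^ (2 * k + 1) * |w ξ| ≤
      (1 + ξ ^ 2) ^ (2 * k + 1) * (|w ξ| + |deriv w ξ| + |deriv (deriv w) ξ|) := fun ξ => by
    nlinarith [abs_nonneg (deriv w ξ), abs_nonneg (deriv (deriv w) ξ), hP1' ξ]
  have iPw : Integrable fun ξ => (1 + ξ ^ 2) ^ k * w ξ := integrable_of_abs_le (hPc.mul hwc) hWint 1 fun ξ => by
    have hb : |(1 + ξ ^ 2) ^ k| ≤ 1 * (1 + ξ ^ 2) ^ k := by rw [abs_of_nonneg (by positivity), one_mul]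
    exact abs_mul_le_of_bounds zero_le_one hb (hPk ξ) (hGw ξ)
  set Pw : ℝ := ∫ ξ, (1 + ξ ^ 2) ^ k * w ξ with hPw
  -- uniform bound `M(τ₀) ≤ C·P`
  have hMle : ∀ τ₀, ∫ ξ, Q τ₀ ξ * w ξ ≤ C * Pw := by
    intro τ₀
    calc ∫ ξ, Q τ₀ ξ * w ξ ≤ ∫ ξ, C * ((1 + ξ ^ 2) ^ k * w ξ) := integral_mono (hint τ₀) (iPw.const_mul C) fun ξ => by
            have h := (le_abs_self _).trans (hQb τ₀ ξ)
            have hw0 := (hwpos ξ).le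
            nlinarith [mul_le_mul_of_nonneg_right h hw0]
      _ = C * Pw := integral_const_mul _ _
  refine ⟨hint, fun τ => ?_⟩
  have hIT : ∀ τ₀, τ₀ ≤ τ → ∫ ξ, Q τ ξ * w ξ ≤ Real.exp (-(γ * (τ - τ₀))) * (C * Pw) + β / γ * Pw := by
    intro τ₀ hτ₀
    have h1 := hdecay τ₀ τ hτ₀
    have h2 : Real.exp (-(γ * (τ - τ₀))) * ∫ ξ, Q τ₀ ξ * w ξ ≤ Real.exp (-(γ * (τ - τ₀))) * (C * Pw) :=
      mul_le_mul_of_nonneg_left (hMle τ₀) (Real.exp_pos _).le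
    linarith
  have hlim : Tendsto (fun τ₀ : ℝ => Real.exp (-(γ * (τ - τ₀))) * (C * Pw) + β / γ * Pw) atBot (𝓝 (0 + β / γ * Pw)) := by
    have h1 : Tendsto (fun τ₀ : ℝ => -(γ * (τ - τ₀))) atBot atBot := by
      have e : (fun τ₀ : ℝ => -(γ * (τ - τ₀))) = fun τ₀ => γ * τ₀ + -(γ * τ) := by funext τ₀; ring
      rw [e]
      exact tendsto_atBot_add_const_right _ _ (tendsto_id.const_mul_atBot hγ)
    have h2 := Real.tendsto_exp_atBot.comp h1
    have h3 : Tendsto (fun τ₀ : ℝ => Real.exp (-(γ * (τ - τ₀))) * (C * Pw)) atBot (𝓝 0) := by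
      simpa using h2.mul_const (C * Pw)
    exact h3.add_const _
  rw [zero_add] at hlim
  exact ge_of_tendsto hlim (eventually_atBot.2 ⟨τ, fun τ₀ h => hIT τ₀ h⟩)

end Summit.NavierStokesRegularity.NavierStokesRegularity.Theorems.PoloidalWindowDoorLrcModEntireTwistingTHOscAncientLiouvilleForced
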